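import Summits.Parity.BatemanHorn.Theorems.PolyMobiusTail.Negative.Equivalence
import Summits.Parity.BatemanHorn.Theorems.PolyMobiusTail.Negative.CancellationAcrossN
import Summits.Parity.BatemanHorn.Theorems.PolyMobiusTail.Negative.LinearSlice
import Summits.Parity.BatemanHorn.Theorems.IsogenyRedeiTypeIMainTerm
import Summits.Parity.BatemanHorn.Theorems.IsogenyRedeiLambdaToCount
import Summits.Parity.BatemanHorn.Theorems.IsogenyRedeiSliceFrame

/-!
# Strategy census for crux `PolyMobiusTail` (stmt-Parity-0870) — typed companion

Crux-strategist `planner-cstrat-stmt-Parity-0870-0` (route `IsogenyRedei`), 2026-08-16.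
Companion to `STRATEGY-CENSUS.md` in this directory.  Every strengthening and decomposition named in the
census is TYPED here over the route's declarations and its glue to the crux is PROVED (no `sorry`), so
that the verdict "no strategy short of the summit" rests on kernel-checked implications, not on prose.

* §0 `batemanHorn_of_polyMobiusTail` — the crux implies the sub-problem statement `BatemanHorn`
  OUTRIGHT: `closes` with its two other hypotheses discharged by the tree theorems
  `typeIMainTerm_proof` (stmt-Parity-0873) and `lambdaToCount_proof` (stmt-Parity-0874).  Together with
  `polyMobiusTail_iff_lambdaBatemanHorn` (Negative/Equivalence) the crux IS Λ-Bateman–Horn for every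
  system: summit-strength is a theorem, not a judgement.
* §S strengthenings.  `polyMobiusTail_iff_uniformEta`: ONE `η` for all systems is EQUIVALENT to the
  crux (via `polyMobiusTail_iff_forall_eta`) — rigidity in `η` buys nothing.
  `polyMobiusTail_of_powerSaving`: an `O(x^{1-δ})` tail implies the crux; this is the shape of the
  `𝔽_q[u]` theorems (Sawin–Shusterman, arXiv:2008.09905 Thm 1.2/1.3) and unlocks no induction or
  compactness over `ℤ`.  Refuted strengthenings (not restated): `polyMobiusTail_allEtaClosed_false`,
  `polyMobiusTail_abs_false`, `polyMobiusTail_primeDivisors_false` (Negative/CancellationAcrossN);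
  uniformity in `f` at log-power heights: `Literature.Barriers.Parity.UniformBatemanHornBarrier`.
* §D decompositions, each with its glue PROVED:
  D1 the route's own frame `sliceFrame_proof` (children = existing items 11584/14950/14951/14952; the
     child `PolyMobiusTailOffGaussian` is the crux minus one system);
  D2 `polyMobiusTail_of_degreeSplit : PolyMobiusTailLinear → PolyMobiusTailNonlinear → PolyMobiusTail`
     (all-linear systems = Hardy–Littlewood prime `k`-tuples in Λ-form, versus systems with a member of
     degree `≥ 2`);
  D3 `polyMobiusTail_of_halves : LambdaLowerHalf → LambdaUpperHalf → PolyMobiusTail` (the lower-bound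
     half = the qualitative conjecture with the right constant, the upper-bound half = the asymptotic
     upper bound; Bombieri's factor-2 indeterminacy sits symmetrically across them).
  Why none gives leverage is argued in STRATEGY-CENSUS.md §Decomposition (padding argument for D2,
  `Literature.NumberTheory.Sieve.bombieri_asymptotic_sieve_indeterminacy` /
  `Literature.Barriers.Parity.SelbergParityBarrier` for D3, the two-layer rule for D1).
* §T / §N (transfer, negation) are prose in STRATEGY-CENSUS.md; the positive anchor
  `tail_X_isLittleO` (the linear slice, PNT + Landau) is restated below as the transfer's base case.
-/

namespace Summit.Parity.BatemanHorn.Cruxes.PolyMobiusTail.StrategyCensus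

open scoped BigOperators
open Filter Asymptotics Polynomial ArithmeticFunction
open Literature.NumberTheory.Sieve
open Summit.Parity.BatemanHorn.Theses.IsogenyRedei
open Summit.Parity.BatemanHorn.Theorems (typeIMainTerm_proof sliceFrame_proof)
open Summit.Parity.BatemanHorn.LambdaToCount (lambdaToCount_proof)
open Summit.Parity.BatemanHorn.Theorems.PolyMobiusTail.Negative
  (polyMobiusTail_iff_lambdaBatemanHorn polyMobiusTail_iff_forall_eta isLittleO_rpow_self_of_lt_one
    tail_X_isLittleO)

/-! ## §0 Summit strength is a theorem -/

/-- **The crux implies the sub-problem statement unconditionally**: `closes` of route `IsogenyRedei`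
with `TypeIMainTerm` and `LambdaToCount` discharged by the tree theorems `typeIMainTerm_proof` and
`lambdaToCount_proof`.  Hence every line / decomposition for the crux is one for `BatemanHorn` itself. -/
theorem batemanHorn_of_polyMobiusTail (h : PolyMobiusTail) : _root_.BatemanHorn :=
  closes h typeIMainTerm_proof lambdaToCount_proof

/-- The tail function of the crux (verbatim the function inside `PolyMobiusTail`). -/
noncomputable def cruxTail {k : ℕ} (f : Fin k → ℤ[X]) (η : ℝ) (x : ℕ) : ℝ :=
  ∑ n ∈ Finset.Icc 1 x, ∑ d ∈ Fintype.piFinset (fun i => (((f i).eval (n : ℤ)).toNat).divisors),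
    if (x : ℝ) ^ (1 - η) < ∏ i, (d i : ℝ) then ∏ i, ((moebius (d i) : ℝ) * Real.log (d i)) else 0

/-- Reading check: the crux in terms of `cruxTail` (definitional). -/
theorem polyMobiusTail_iff_cruxTail :
    PolyMobiusTail ↔ ∀ (k : ℕ) (f : Fin k → ℤ[X]), IsBatemanHornSystem f →
      ∃ η : ℝ, 0 < η ∧ η < 1 ∧ (cruxTail f η) =o[atTop] fun x : ℕ => (x : ℝ) :=
  Iff.rfl

/-! ## §T Transfer base case: the one slice that is a theorem -/

/-- The linear slice `f = (X)` of the crux holds at every `η ∈ (0,1)` (PNT + Landau, tree theorem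
`tail_X_isLittleO`).  The transfer census (STRATEGY-CENSUS.md §Transfer, T1) starts from this anchor and
records where the Euler-product step breaks for `deg f ≥ 2`. -/
theorem linearSlice_anchor {η : ℝ} (hη0 : 0 < η) (hη1 : η < 1) :
    (cruxTail ![(X : ℤ[X])] η) =o[atTop] fun x : ℕ => (x : ℝ) :=
  tail_X_isLittleO hη0 hη1

/-! ## §S Strengthenings -/

/-- **S⁺₁ — one `η` serving every system.** -/
def PolyMobiusTailUniformEta : Prop :=
  ∃ η : ℝ, 0 < η ∧ η < 1 ∧ ∀ (k : ℕ) (f : Fin k → ℤ[X]), IsBatemanHornSystem f →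
    (cruxTail f η) =o[atTop] fun x : ℕ => (x : ℝ)

/-- S⁺₁ is NOT stronger: by `η`-rigidity (`polyMobiusTail_iff_forall_eta`, with `TypeIMainTerm` now a
theorem) the crux already gives the tail bound at `η = 1/2` for every system.  A strengthening that is
equivalent to the statement exposes nothing new. -/
theorem polyMobiusTail_iff_uniformEta : PolyMobiusTail ↔ PolyMobiusTailUniformEta := by
  constructor
  · intro h
    refine ⟨1 / 2, by norm_num, by norm_num, fun k f hf => ?_⟩
    exact (polyMobiusTail_iff_forall_eta typeIMainTerm_proof).mp h k f hf (1 / 2)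
      (by norm_num) (by norm_num)
  · rintro ⟨η, h0, h1, h⟩ k f hf
    exact ⟨η, h0, h1, h k f hf⟩

/-- **S⁺₂ — power saving** (the shape in which the `𝔽_q[u]` analogues are theorems). -/
def PolyMobiusTailPowerSaving : Prop :=
  ∀ (k : ℕ) (f : Fin k → ℤ[X]), IsBatemanHornSystem f →
    ∃ η δ : ℝ, 0 < η ∧ η < 1 ∧ 0 < δ ∧ (cruxTail f η) =O[atTop] fun x : ℕ => (x : ℝ) ^ (1 - δ)

/-- S⁺₂ implies the crux (routine: `x^{1-δ} = o(x)`).  It is genuinely stronger and admits no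
induction / compactness argument over `ℤ` that the crux lacks (STRATEGY-CENSUS.md §Strengthen). -/
theorem polyMobiusTail_of_powerSaving (h : PolyMobiusTailPowerSaving) : PolyMobiusTail := by
  intro k f hf
  obtain ⟨η, δ, h0, h1, hδ, hO⟩ := h k f hf
  have hsmall : (fun x : ℕ => (x : ℝ) ^ (1 - δ)) =o[atTop] fun x : ℕ => (x : ℝ) :=
    (isLittleO_rpow_self_of_lt_one (s := 1 - δ) (by linarith)).comp_tendsto
      tendsto_natCast_atTop_atTop
  exact ⟨η, h0, h1, hO.trans_isLittleO hsmall⟩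

/-! ## §D Decompositions -/

/-- **D1 — the route's own frame**, glue already a tree theorem (`sliceFrame_proof`, stmt-Parity-14953):
the four children are the existing items `PencilSelmerDictionary` (11584), `PencilSelmerParitySW`
(14950), `GaussianTailLargeCofactor` (14951), `PolyMobiusTailOffGaussian` (14952). -/
example : PencilSelmerDictionary → PencilSelmerParitySW → GaussianTailLargeCofactor →
    PolyMobiusTailOffGaussian → PolyMobiusTail :=
  sliceFrame_proof

/-- **D2a — the all-linear systems** (Dickson / Hardy–Littlewood prime `k`-tuples in Λ-form; the
`d = 1` core of the summit's other conjunct `GeneralizedHardyLittlewood`). -/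
def PolyMobiusTailLinear : Prop :=
  ∀ (k : ℕ) (f : Fin k → ℤ[X]), IsBatemanHornSystem f → (∀ i, (f i).natDegree ≤ 1) →
    ∃ η : ℝ, 0 < η ∧ η < 1 ∧ (cruxTail f η) =o[atTop] fun x : ℕ => (x : ℝ)

/-- **D2b — systems with a member of degree `≥ 2`** (the Bunyakovsky–Schinzel part; thin sets,
`c ≥ 1/2`, `Literature.Barriers.Parity.FordMaynardLowLevel`). -/
def PolyMobiusTailNonlinear : Prop :=
  ∀ (k : ℕ) (f : Fin k → ℤ[X]), IsBatemanHornSystem f → (∃ i, 2 ≤ (f i).natDegree) →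
    ∃ η : ℝ, 0 < η ∧ η < 1 ∧ (cruxTail f η) =o[atTop] fun x : ℕ => (x : ℝ)

/-- D2 glue: a plain case split on the degree profile. -/
theorem polyMobiusTail_of_degreeSplit (hL : PolyMobiusTailLinear) (hN : PolyMobiusTailNonlinear) :
    PolyMobiusTail := by
  intro k f hf
  by_cases h : ∀ i, (f i).natDegree ≤ 1
  · exact hL k f hf h
  · push Not at h
    obtain ⟨i, hi⟩ := h
    exact hN k f hf ⟨i, by omega⟩

/-- **D3a — the lower-bound half of Λ-Bateman–Horn**: for every system and every `ε > 0`,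
eventually `∑_{n ≤ x} ∏ Λ(fᵢ(n)) ≥ (1 - ε) C(f) x`.  (Any fixed `ε < 1` already gives infinitely many
prime-power tuples: `Negative/Equivalence.infinite_primePow_tuples_of_linear_lower`.) -/
def LambdaLowerHalf : Prop :=
  ∀ (k : ℕ) (f : Fin k → ℤ[X]), IsBatemanHornSystem f → ∀ C : ℝ, HasBatemanHornConst f C →
    ∀ ε : ℝ, 0 < ε → ∀ᶠ x : ℕ in atTop,
      (1 - ε) * (C * (x : ℝ)) ≤ ∑ n ∈ Finset.Icc 1 x, ∏ i, vonMangoldt (((f i).eval (n : ℤ)).toNat)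

/-- **D3b — the upper-bound half of Λ-Bateman–Horn**: eventually `∑_{n ≤ x} ∏ Λ(fᵢ(n)) ≤ (1 + ε) C(f) x`.
(In print only with `2^k k! ∏ deg fᵢ` in place of `1 + ε`: Bateman–Horn 1962 (2).) -/
def LambdaUpperHalf : Prop :=
  ∀ (k : ℕ) (f : Fin k → ℤ[X]), IsBatemanHornSystem f → ∀ C : ℝ, HasBatemanHornConst f C →
    ∀ ε : ℝ, 0 < ε → ∀ᶠ x : ℕ in atTop,
      ∑ n ∈ Finset.Icc 1 x, ∏ i, vonMangoldt (((f i).eval (n : ℤ)).toNat) ≤ (1 + ε) * (C * (x : ℝ))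

/-- D3 glue: the two halves give the Λ-asymptotic, hence the crux by
`polyMobiusTail_iff_lambdaBatemanHorn` (with `TypeIMainTerm` discharged by `typeIMainTerm_proof`). -/
theorem polyMobiusTail_of_halves (hLo : LambdaLowerHalf) (hUp : LambdaUpperHalf) : PolyMobiusTail := by
  rw [polyMobiusTail_iff_lambdaBatemanHorn typeIMainTerm_proof]
  intro k f hf
  obtain ⟨C, hC, hHas, -⟩ := typeIMainTerm_proof k f hf (1 / 2) (by norm_num) (by norm_num)
  refine ⟨C, hC, hHas, ?_⟩
  show ((fun x : ℕ => ∑ n ∈ Finset.Icc 1 x, ∏ i, vonMangoldt (((f i).eval (n : ℤ)).toNat))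
      - fun x : ℕ => C * (x : ℝ)) =o[atTop] fun x : ℕ => C * (x : ℝ)
  rw [Asymptotics.isLittleO_iff]
  intro c hc
  filter_upwards [hLo k f hf C hHas c hc, hUp k f hf C hHas c hc] with x hlo hup
  have hCx : 0 ≤ C * (x : ℝ) := mul_nonneg hC.le (Nat.cast_nonneg x)
  have e1 : (1 - c) * (C * (x : ℝ)) = C * x - c * (C * x) := by ring
  have e2 : (1 + c) * (C * (x : ℝ)) = C * x + c * (C * x) := by ring
  rw [e1] at hlo
  rw [e2] at hup
  simp only [Pi.sub_apply, Real.norm_eq_abs, abs_of_nonneg hCx]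
  rw [abs_le]
  exact ⟨by linarith, by linarith⟩

end Summit.Parity.BatemanHorn.Cruxes.PolyMobiusTail.StrategyCensus
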